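import Literature.Analysis.FluidPDE.PassiveScalarClassicalEnergy
import HarnessLib

/-!
# Forward–backward duality for classical advection–diffusion on the torus

Analysis/FluidPDE proof-support file (everything proved). Let `θ` be a classical solution of
`∂ₜθ + v·∇θ = κΔθ` on `[0,τ] × T^d` and let `χ` be a classical solution of the same equation with
the **time-reversed, sign-reversed drift** `v'(σ) = -v(τ - σ)` on `[0,τ] × T^d`. Then
`σ ↦ χ(τ - σ)` solves the *backward* (adjoint) equation `∂ₜψ + v·∇ψ + κΔψ = 0`, and the pairing
`t ↦ ∫ θ(t) χ(τ - t)` is constant (`div v = 0` and Green's identity), whence the duality identity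

  `∫ θ(τ) χ(0) = ∫ θ(0) χ(τ)`   (`IsClassicalScalarTransportOn.integral_mul_eq_of_reverse`).

This is the classical adjoint relation between the forward problem and the backward Kolmogorov
equation of the (time-reversed) diffusion process (Evans 2010, §7.1.1 and Problem 7.5/7: the formal
adjoint of `-κΔ + v·∇` with `div v = 0` is `-κΔ - v·∇`); we also record the smoothness and
incompressibility of reversed and shifted drifts used to build such `χ` from the tree's classical
well-posedness theorem.

## References

* L. C. Evans, *Partial Differential Equations*, 2nd ed., AMS (2010), §7.1.1–7.1.2. [`Evans2010`]
-/

noncomputable section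

open MeasureTheory Set Filter Topology Function
open scoped InnerProductSpace ContDiff
open Literature.Analysis.FunctionSpaces Literature.Analysis.FunctionSpaces.Torus

namespace Literature.Analysis.FluidPDE

namespace Torus

variable {d : Type*} [Fintype d] [DecidableEq d]

/-! ## Affine reparametrisations of time -/

section Affine

variable {F : Type*} [NormedAddCommGroup F] [NormedSpace ℝ F]

omit [DecidableEq d] in
/-- Composition with an affine time map sending `S'` into `S` preserves joint smoothness. [folklore] -/
theorem isSmoothSpaceTimeOn_comp_affine {S S' : Set ℝ} {w : ℝ → UnitAddTorus d → F}
    (hw : IsSmoothSpaceTimeOn S w) {a c : ℝ} (hsub : ∀ t ∈ S', a * t + c ∈ S) :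
    IsSmoothSpaceTimeOn S' (fun t => w (a * t + c)) := by
  have hφ : ContDiff ℝ ∞ (fun z : ℝ × EuclideanSpace ℝ d => (a * z.1 + c, z.2)) :=
    ((contDiff_const.mul contDiff_fst).add contDiff_const).prodMk contDiff_snd
  have hmaps : MapsTo (fun z : ℝ × EuclideanSpace ℝ d => (a * z.1 + c, z.2)) (S' ×ˢ univ) (S ×ˢ univ) :=
    fun z hz => ⟨hsub z.1 hz.1, mem_univ _⟩
  change ContDiffOn ℝ ∞ (stLift w ∘ fun z : ℝ × EuclideanSpace ℝ d => (a * z.1 + c, z.2)) (S' ×ˢ univ)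
  exact hw.comp hφ.contDiffOn hmaps

omit [DecidableEq d] in
/-- **Time reversal** `t ↦ τ - t` preserves joint smoothness on `[0, τ]`. [folklore] -/
theorem IsSmoothSpaceTimeOn.reverse {τ : ℝ} {w : ℝ → UnitAddTorus d → F}
    (hw : IsSmoothSpaceTimeOn (Icc 0 τ) w) : IsSmoothSpaceTimeOn (Icc 0 τ) (fun t => w (τ - t)) := by
  have h := isSmoothSpaceTimeOn_comp_affine hw (S' := Icc 0 τ) (a := -1) (c := τ)
    (fun t ht => ⟨by linarith [ht.2], by linarith [ht.1]⟩)
  refine (h.congr fun p _ => ?_)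
  simp only [neg_one_mul, neg_add_eq_sub]

omit [DecidableEq d] in
/-- **Time shift**: smoothness on `[0, T]` gives smoothness of `t ↦ w (t + a)` on `[0, τ]` whenever
`0 ≤ a` and `a + τ ≤ T`. [folklore] -/
theorem IsSmoothSpaceTimeOn.shift {T τ a : ℝ} {w : ℝ → UnitAddTorus d → F}
    (hw : IsSmoothSpaceTimeOn (Icc 0 T) w) (ha : 0 ≤ a) (haτ : a + τ ≤ T) :
    IsSmoothSpaceTimeOn (Icc 0 τ) (fun t => w (t + a)) := by
  have h := isSmoothSpaceTimeOn_comp_affine hw (S' := Icc 0 τ) (a := 1) (c := a)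
    (fun t ht => ⟨by linarith [ht.1], by linarith [ht.2]⟩)
  refine (h.congr fun p _ => ?_)
  simp only [one_mul]

omit [Fintype d] [DecidableEq d] in
/-- The one-sided time derivative of the reversed field: for `t ∈ [0, τ]`, `τ > 0`,
`∂ₜ (χ(τ - ·)) (t) = -(∂ₜχ)(τ - t)` (chain rule within `[0, τ]`). [folklore] -/
theorem timeDerivWithin_reverse [Fintype d] {τ : ℝ} (hτ : 0 < τ) {χ : ℝ → UnitAddTorus d → F}
    (hχ : IsSmoothSpaceTimeOn (Icc 0 τ) χ) {t : ℝ} (ht : t ∈ Icc 0 τ) (x : UnitAddTorus d) :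
    timeDerivWithin (Icc 0 τ) (fun s => χ (τ - s)) t x = -timeDerivWithin (Icc 0 τ) χ (τ - t) x := by
  have hmem : τ - t ∈ Icc 0 τ := ⟨by linarith [ht.2], by linarith [ht.1]⟩
  have h1 := hχ.hasDerivWithinAt_slice hmem x
  have h2 : HasDerivWithinAt (fun s : ℝ => τ - s) (-1) (Icc 0 τ) t := by
    simpa using (hasDerivWithinAt_id t (Icc 0 τ)).const_sub τ
  have hmaps : MapsTo (fun s : ℝ => τ - s) (Icc 0 τ) (Icc 0 τ) :=
    fun s hs => ⟨by linarith [hs.2], by linarith [hs.1]⟩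
  have h3 : HasDerivWithinAt (fun s => χ (τ - s) x) ((-1 : ℝ) • timeDerivWithin (Icc 0 τ) χ (τ - t) x)
      (Icc 0 τ) t := h1.scomp t h2 hmaps
  rw [timeDerivWithin, h3.derivWithin (uniqueDiffOn_Icc hτ t ht), neg_one_smul]

end Affine

/-! ## Reversed drifts -/

omit [Fintype d] [DecidableEq d] in
/-- `div (-v) = -div v` (pointwise, no regularity needed). [folklore] -/
theorem divergence_neg' [Fintype d] [DecidableEq d] (v : UnitAddTorus d → EuclideanSpace ℝ d) (x : UnitAddTorus d) :
    divergence (fun y => -v y) x = -divergence v x := by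
  simp only [divergence, partialDeriv, FunctionSpaces.Torus.lineDeriv, PiLp.neg_apply, deriv.fun_neg,
    Finset.sum_neg_distrib]

/-- The reversed drift `σ ↦ -v(τ - σ)` is divergence free along with `v`. [folklore] -/
theorem isDivFree_reverse {τ : ℝ} {v : ℝ → UnitAddTorus d → EuclideanSpace ℝ d}
    (hdiv : ∀ t ∈ Icc 0 τ, IsDivFree (v t)) : ∀ σ ∈ Icc 0 τ, IsDivFree (fun x => -v (τ - σ) x) := by
  intro σ hσ x
  rw [divergence_neg', hdiv (τ - σ) ⟨by linarith [hσ.2], by linarith [hσ.1]⟩ x, neg_zero]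

omit [DecidableEq d] in
/-- The reversed drift `σ ↦ -v(τ - σ)` is jointly smooth on `[0, τ]` along with `v`. [folklore] -/
theorem isSmoothSpaceTimeOn_reverse_neg {τ : ℝ} {v : ℝ → UnitAddTorus d → EuclideanSpace ℝ d}
    (hv : IsSmoothSpaceTimeOn (Icc 0 τ) v) : IsSmoothSpaceTimeOn (Icc 0 τ) (fun σ x => -v (τ - σ) x) :=
  (IsSmoothSpaceTimeOn.reverse hv).neg

/-! ## The duality identity -/

namespace IsClassicalScalarTransportOn

variable {κ τ : ℝ} {v v' : ℝ → UnitAddTorus d → EuclideanSpace ℝ d} {θ χ : ℝ → UnitAddTorus d → ℝ}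

/-- **Forward–backward duality** (Evans 2010, §7.1.1: the adjoint of `-κΔ + v·∇`, `div v = 0`, is
`-κΔ - v·∇`). If `θ` solves `∂ₜθ + v·∇θ = κΔθ` on `[0,τ]` and `χ` solves the same equation with the
reversed drift `v'(σ) = -v(τ - σ)` on `[0,τ]`, then `∫ θ(τ) χ(0) = ∫ θ(0) χ(τ)`: the pairing
`t ↦ ∫ θ(t) χ(τ - t)` has zero derivative (`∫ (Δθ)ψ = ∫ θ Δψ` and `∫ θ v·∇ψ + ∫ (v·∇θ) ψ = 0`).
[cite: Evans2010, §7.1.1] -/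
theorem integral_mul_eq_of_reverse (hτ : 0 < τ) (hθ : IsClassicalScalarTransportOn (Icc 0 τ) κ v θ)
    (hχ : IsClassicalScalarTransportOn (Icc 0 τ) κ v' χ)
    (hrel : ∀ σ ∈ Icc 0 τ, ∀ x, v' σ x = -v (τ - σ) x) :
    ∫ x, θ τ x * χ 0 x = ∫ x, θ 0 x * χ τ x := by
  have hU : UniqueDiffOn ℝ (Icc 0 τ) := uniqueDiffOn_Icc hτ
  -- the reversed field and the pairing
  set χr : ℝ → UnitAddTorus d → ℝ := fun t x => χ (τ - t) x with hχr
  have hχrs : IsSmoothSpaceTimeOn (Icc 0 τ) χr := IsSmoothSpaceTimeOn.reverse hχ.smooth_scalar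
  have hθs := hθ.smooth_scalar
  have hΦ : IsSmoothSpaceTimeOn (Icc 0 τ) (fun t x => θ t x * χr t x) := hθs.mul hχrs
  set F : ℝ → ℝ := fun t => ∫ x, θ t x * χr t x with hF
  -- the derivative of the pairing vanishes
  have hderiv : ∀ t ∈ Icc 0 τ, HasDerivWithinAt F 0 (Icc 0 τ) t := by
    intro t ht
    have hmem : τ - t ∈ Icc 0 τ := ⟨by linarith [ht.2], by linarith [ht.1]⟩
    have hθt : IsSmooth (θ t) := hθs.isSmooth_slice ht
    have hχt : IsSmooth (χr t) := hχrs.isSmooth_slice ht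
    have hvt : IsSmooth (v t) := hθ.smooth_velocity.isSmooth_slice ht
    have hE := hΦ.hasDerivWithinAt_integral (convex_Icc 0 τ) ht
    -- pointwise: the time derivative of the integrand
    have hpt : ∀ x, timeDerivWithin (Icc 0 τ) (fun t x => θ t x * χr t x) t x =
        κ * (laplacian (θ t) x * χr t x - θ t x * laplacian (χr t) x) -
          (θ t x * ⟪v t x, gradient (χr t) x⟫_ℝ + ⟪v t x, gradient (θ t) x⟫_ℝ * χr t x) := by
      intro x
      have h1 := hθs.hasDerivWithinAt_slice ht x
      have h2 := hχrs.hasDerivWithinAt_slice ht x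
      have h12 : HasDerivWithinAt (fun s => θ s x * χr s x)
          (timeDerivWithin (Icc 0 τ) θ t x * χr t x + θ t x * timeDerivWithin (Icc 0 τ) χr t x) (Icc 0 τ) t :=
        h1.mul h2
      have hprod : timeDerivWithin (Icc 0 τ) (fun t x => θ t x * χr t x) t x =
          timeDerivWithin (Icc 0 τ) θ t x * χr t x + θ t x * timeDerivWithin (Icc 0 τ) χr t x := by
        rw [timeDerivWithin, h12.derivWithin (hU t ht)]
      have hdθ : timeDerivWithin (Icc 0 τ) θ t x =
          κ * laplacian (θ t) x - ⟪v t x, gradient (θ t) x⟫_ℝ := by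
        have := hθ.transport t ht x; linarith
      have hdχ : timeDerivWithin (Icc 0 τ) χr t x =
          -(κ * laplacian (χr t) x) - ⟪v t x, gradient (χr t) x⟫_ℝ := by
        have e1 : timeDerivWithin (Icc 0 τ) χr t x = -timeDerivWithin (Icc 0 τ) χ (τ - t) x :=
          timeDerivWithin_reverse hτ hχ.smooth_scalar ht x
        have e2 := hχ.transport (τ - t) hmem x
        have e3 : v' (τ - t) x = -v t x := by rw [hrel (τ - t) hmem x, sub_sub_cancel]
        rw [e3, inner_neg_left] at e2
        have e4 : timeDerivWithin (Icc 0 τ) χ (τ - t) x =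
            κ * laplacian (χ (τ - t)) x + ⟪v t x, gradient (χ (τ - t)) x⟫_ℝ := by linarith
        rw [e1, e4]
        show -(κ * laplacian (χr t) x + ⟪v t x, gradient (χr t) x⟫_ℝ) = _
        ring
      rw [hprod, hdθ, hdχ]
      ring
    -- integrate: Green's identity and the transport identity
    have hval : ∫ x, timeDerivWithin (Icc 0 τ) (fun t x => θ t x * χr t x) t x = 0 := by
      have i1 : Integrable (fun x => laplacian (θ t) x * χr t x) volume :=
        (hθt.laplacian.smul' hχt).integrable
      have i2 : Integrable (fun x => θ t x * laplacian (χr t) x) volume :=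
        (hθt.smul' hχt.laplacian).integrable
      have i3 : Integrable (fun x => θ t x * ⟪v t x, gradient (χr t) x⟫_ℝ) volume :=
        (hθt.smul' (hvt.inner hχt.gradient)).integrable
      have i4 : Integrable (fun x => ⟪v t x, gradient (θ t) x⟫_ℝ * χr t x) volume :=
        ((hvt.inner hθt.gradient).smul' hχt).integrable
      simp_rw [hpt]
      rw [integral_sub, integral_const_mul, integral_sub i1 i2, integral_add i3 i4,
        integral_mul_inner_gradient_add_eq_zero hvt (hθ.divFree t ht) hθt hχt,
        FunctionSpaces.Torus.integral_mul_laplacian_comm_holds hθt hχt, sub_self, mul_zero, sub_zero]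
      · exact (i1.sub i2).const_mul κ
      · exact i3.add i4
    rw [hval] at hE
    exact hE
  -- hence the pairing is constant on `[0, τ]`
  have hcont : ContinuousOn F (Icc 0 τ) := hΦ.continuousOn_integral (convex_Icc 0 τ)
  have hconst := constant_of_has_deriv_right_zero hcont (fun t ht => by
    have h := hderiv t (Ico_subset_Icc_self ht)
    refine h.mono_of_mem_nhdsWithin ?_
    exact mem_of_superset (Icc_mem_nhdsGE ht.2) (Icc_subset_Icc ht.1 le_rfl))
  have h := hconst τ (right_mem_Icc.2 hτ.le)
  simp only [hF, hχr, sub_self, sub_zero] at h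
  exact h

end IsClassicalScalarTransportOn

end Torus

end Literature.Analysis.FluidPDE
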